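import Summits.QuantumFields.BalabanUV.Beta.D1BFx.ChartDefectRowMsMass
import Summits.QuantumFields.BalabanUV.Beta.D1BFx.SymHessTableMass
import Summits.QuantumFields.BalabanUV.Beta.D1BFx.RoadPinKernelBdd
import Summits.QuantumFields.BalabanUV.Beta.D1BFx.ChartDefectRowLamfMass

/-!
# `BalabanUV.Beta.D1BFx.ChartDefectRowMsScales` — road «BF-x», binder row D1, PART 24-hyb HEAD ON THE SCALES (`ChartDefectHeadScales`' rows): **ROW (ms) WITH ONE
# m-INDEPENDENT CONSTANT** (leaf-03 g34, TT34; the scales form of TT28 `ChartDefectRowMsMass`, the (ms) twin of TT33 `ChartDefectRowLamfScales`).  At every scale `n = Lc^m` the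
# (ms) row kernel `Wms m a e z := ½·tadpole G₀ (WMs[G₀] a 0 e z)` (the pin `hWms` of `ChartDefectHeadScales.abs_secondMoment_chartDefect_scales_le_of_rows`, VERBATIM up to bound-variable
# names) has absolutely summable (1.22) second moments and `|secondMoment (Wms m) μ ν| ≤ C_ms*` with `C_ms*` FIXED BEFORE `∀ m` — modulo the straight kernel's m-uniform sup letter
# `∀ m, Bdd (KInvStep 3 (Lc^m) 0) S₀` and the multiplier-column envelope `∀ m, |wΦ (N := Lc^m) ρ ν w| ≤ CΦ·((Lc^m)⁵)⁻¹·((Lc^m)³)⁻¹·e^{−κ₀‖w‖∞}` (one `CΦ`, `κ₀ > 0` — gan24-leaf-05 g61∕g63's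
# `hΦ`, the letter every (M-b) row displays):
# `C_ms* = ((1∕4)·(S₀·(2·GΘ*·(289·MV_H*) + 2·GΘ*·(289·MV_H*))))·Σ'_x |x|₁²e^{−(κ₁∕16)|x|₁}`, `κ₁ := min κ′ κ₀`, `GΘ* = 32·C_G′·e^{2κ′}`, `MV_H* = K_Φ·(200·e^{κ₁})`.
HOW.  Per scale the row is TT28 `decay510_row_ms_mass_of_wmass` at the n-FREE rate `σ_m := κ₁∕(16·Lc^m)` (`σ_m ≤ r_G` and `σ_m ≤ κ₀∕(16n)`) with the vertex letter `hV :=` g63 «H-TABLE-MASS»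
PART B `SymHessTableMass.wmass_vertexOfM_K₀_symHessFFAt_le_pairMass` (NO lattice volume at a fine rate; `MV_H(n) ≍ n⁻⁶·CΦ`) and the leg `Bdd G₀ ((1+16n)²·S₀)` (g63 «G0-BDD»
`bdd_G₀_of_bdd`); §1 proves the m-INDEPENDENT MAJORANTS `GΘ(n) ≤ GΘ*` (`GΘ(n) = 32·C_G′·n⁻³·e^{r_G(|ρ_c|₁+4n)}`, TT31 `exp_rG_le`) and `(1+16n)²·MV_H(n) ≤ 289·MV_H*`
(`ell 4 n = 10n`, `(17n)²·200n²·n⁻⁸ ≤ 289·200`), then lit `decay510_mono_const`, `absMoment₂_of_decay510`, `secondMoment_abs_le_of_decay510`.  No `n = 1` special case ((ms) has no split).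
[folklore] real-inequality bookkeeping BY NAME over TT28 ∕ g63; no definition, no `def … : Prop`, nothing cited, 0 sorry.  LOCATED (zero weight): `C_ms(n) ≍ S₀·CΦ·n⁻⁷`; the constant here
is its value at `n = 1` — m-independence, not sharpness, is the Scales binder's question.

HONEST DEPENDENCY (cell records, verbatim): «continuum YM on T⁴ ⇐ BetaPertH ∧ nine spine estimates (0/9 proved); BetaPertH ⇐ (D1) ∧ (D4) ∧
CAP+tail; G-an2-4 gates asym, D1 and NE2/3/4.»  HONEST FRAMING (cell contract, verbatim): «discharging `BetaPertH` makes Bałaban's UV stability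
UNCONDITIONAL — a real constructive-QFT result; it is NOT the continuum limit and NOT the Clay problem.»  ONE displayed row of the HEAD-on-the-scales priced MODULO two displayed
m-uniform letters (`S₀`, `hΦ`) whose provenance is NOT discharged here — per-word INTERMEDIATE (an2 R-D1-g45-4 (3)), not the HEAD, not the END.  0∕4 row-D1 binders
(hW ∕ hR ∕ D1Tel ∕ D1Rep); (J1) ONE OPEN ROW (eight displayed rows); (K) NOT closed; NOT D1, NEVER «G-an2-4 closed», NOT `BetaPertH`, NOT continuum, NOT Clay.

ABSOLUTE RULE (cell charter, verbatim): «No internally-minted statement may enter as a cited fact. Every hypothesis is either kernel-proved in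
this package or a verbatim quotation of a PUBLISHED theorem with page reference. The manuscript(s) under audit are NOT citable for their own
disputed steps — they are the thing under adjudication; programme-internal (2001/route/tribunal) claims are never citable.»

Unit `b2b-balaban-beta-d1-formalise-leaf-03` (gen 34), D1 formalisation swarm LEAF PROVER 03, road «BF-x»; 2026-08-24.  No existing file touched.
-/

noncomputable section

namespace Summit.QuantumFields.BalabanUV.Beta.D1BFx.ChartDefectRowMsScales

open Finset
open scoped BigOperators
open Literature.MathematicalPhysics.QuantumFieldTheory
open Literature.MathematicalPhysics.QuantumFieldTheory.Balaban1983to89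
open Literature.MathematicalPhysics.QuantumFieldTheory.Balaban1983to89.Beta
open B12Sec2to5 (l1 l1_nonneg Decay510 secondMoment_abs_le_of_decay510)
open DecimatedMomentSummable (AbsMoment₂ absMoment₂_of_decay510)
open B4ContourShift (supNorm)
open B5Hk163Strip (kappa163 kappa163_pos)
open B5Hk163Decay (MG163)
open B4TorusKernel (periodConst)
open ExpKernelCalculus (Site MKer Zl Zl_nonneg comp tadpole decay510_mono_const)
open AveragingHessianKernels (ell)
open AffineAveraging (box toSite)
open AveragingContours (blk)
open AveragingContoursRooted (ctr ctrOff ctrOff_mem_box)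
open KernelSpecInstance (wΦ)
open KernelWard (Bdd)
open OneStepResolventKernel (Fib KInv)
open OneStepKernelFamily (colH KInvStep vertexOfK)
open SecondOrderResponse (vertexOfM mixOfK)
open Summit.QuantumFields.BalabanUV.Beta.BorderedHessian (diagK)
open Summit.QuantumFields.BalabanUV.Beta.AxialDressingRooted (coDressKBmAt)
open Summit.QuantumFields.BalabanUV.Beta.AveragingWardRootedStencils (legSite)
open Summit.QuantumFields.BalabanUV.Beta.CompositeCorrectorLocality (blockSitesF)
open Summit.QuantumFields.BalabanUV.Beta.SymAveragingHessianCounts (symVhSAt symHessFFAt)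
open Summit.QuantumFields.BalabanUV.Beta.SymCorrectorFace (faceWt)
open Summit.QuantumFields.BalabanUV.Beta.D1BFx.RoadPinKernelBdd (bdd_G₀_of_bdd)
open Summit.QuantumFields.BalabanUV.Beta.D1BFx.SymHessTableMass (wmass_vertexOfM_K₀_symHessFFAt_le_pairMass)
open Summit.QuantumFields.BalabanUV.Beta.D1BFx.ChartDefectRowMsMass (decay510_row_ms_mass_of_wmass)
open Summit.QuantumFields.BalabanUV.Beta.D1BFx.ChartDefectRowLamfMass (exp_rG_le cG_nonneg)

variable {d : ℕ}

/-! ## §1 The m-independent majorants (`n ≥ 1`) -/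

section Majorants

variable (n : ℕ) [NeZero n]

/-- [folklore] **THE FACE GENERATOR `Θ′`'s ENVELOPE, m-INDEPENDENT MAJORANT**: `GΘ(n) = ((n⁴)⁻¹·C_G′)·(2·(4·(n·4)))·e^{r_G(|ρ_c|₁+4n)} ≤ GΘ* := 32·C_G′·e^{2κ′}`
(`(n⁴)⁻¹·32n = 32·n⁻³ ≤ 32`, TT31 `exp_rG_le`). -/
theorem faceGenConst_le (hn : 1 ≤ n) :
    (((((n : ℕ) : ℝ) ^ 4)⁻¹ * ((MG163 4 * periodConst (kappa163 4) 3) * (1 + 8 * (1 + Real.exp (kappa163 4 / 4))) * Real.exp (kappa163 4 / 4)))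
          * (2 * ((((3 : ℕ) : ℝ) + 1) * ((n : ℝ) * (((3 : ℕ) : ℝ) + 1))))
          * Real.exp (kappa163 4 / 4 / (4 * ((n : ℕ) : ℝ)) * (l1 (ctr 4 n) + (((3 + 1 : ℕ) : ℝ) * (n : ℝ))))) ≤ ((32 * ((MG163 4 * periodConst (kappa163 4) 3) * (1 + 8 * (1 + Real.exp (kappa163 4 / 4))) * Real.exp (kappa163 4 / 4))) * Real.exp (2 * (kappa163 4 / 4))) := by
  have hn0 : (n : ℝ) ≠ 0 := by exact_mod_cast (NeZero.ne n)
  have hnpos : (0 : ℝ) < n := by exact_mod_cast hn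
  have hn1 : (1 : ℝ) ≤ n := by exact_mod_cast hn
  have hC2 := cG_nonneg
  have hE := exp_rG_le n hn
  -- the polynomial part: `(n⁴)⁻¹·C_G′·(2·(4·(n·4))) = 32·C_G′·n⁻³ ≤ 32·C_G′`
  have hpoly : ((((n : ℕ) : ℝ) ^ 4)⁻¹ * (((MG163 4 * periodConst (kappa163 4) 3) * (1 + 8 * (1 + Real.exp (kappa163 4 / 4))) * Real.exp (kappa163 4 / 4)))) * (2 * ((((3 : ℕ) : ℝ) + 1) * ((n : ℝ) * (((3 : ℕ) : ℝ) + 1))))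
      ≤ 32 * ((MG163 4 * periodConst (kappa163 4) 3) * (1 + 8 * (1 + Real.exp (kappa163 4 / 4))) * Real.exp (kappa163 4 / 4)) := by
    have e : ((((n : ℕ) : ℝ) ^ 4)⁻¹ * (((MG163 4 * periodConst (kappa163 4) 3) * (1 + 8 * (1 + Real.exp (kappa163 4 / 4))) * Real.exp (kappa163 4 / 4)))) * (2 * ((((3 : ℕ) : ℝ) + 1) * ((n : ℝ) * (((3 : ℕ) : ℝ) + 1))))
        = 32 * ((MG163 4 * periodConst (kappa163 4) 3) * (1 + 8 * (1 + Real.exp (kappa163 4 / 4))) * Real.exp (kappa163 4 / 4)) * ((n : ℝ) ^ 3)⁻¹ := by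
      push_cast; field_simp; ring
    rw [e]
    have h3 : ((n : ℝ) ^ 3)⁻¹ ≤ 1 := inv_le_one_of_one_le₀ (one_le_pow₀ hn1)
    have h32 : 0 ≤ 32 * ((MG163 4 * periodConst (kappa163 4) 3) * (1 + 8 * (1 + Real.exp (kappa163 4 / 4))) * Real.exp (kappa163 4 / 4)) := by positivity
    nlinarith
  have hpoly0 : 0 ≤ ((((n : ℕ) : ℝ) ^ 4)⁻¹ * (((MG163 4 * periodConst (kappa163 4) 3) * (1 + 8 * (1 + Real.exp (kappa163 4 / 4))) * Real.exp (kappa163 4 / 4)))) * (2 * ((((3 : ℕ) : ℝ) + 1) * ((n : ℝ) * (((3 : ℕ) : ℝ) + 1)))) := by positivity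
  calc (((((n : ℕ) : ℝ) ^ 4)⁻¹ * ((MG163 4 * periodConst (kappa163 4) 3) * (1 + 8 * (1 + Real.exp (kappa163 4 / 4))) * Real.exp (kappa163 4 / 4)))
          * (2 * ((((3 : ℕ) : ℝ) + 1) * ((n : ℝ) * (((3 : ℕ) : ℝ) + 1))))
          * Real.exp (kappa163 4 / 4 / (4 * ((n : ℕ) : ℝ)) * (l1 (ctr 4 n) + (((3 + 1 : ℕ) : ℝ) * (n : ℝ)))))
      ≤ ((((n : ℕ) : ℝ) ^ 4)⁻¹ * (((MG163 4 * periodConst (kappa163 4) 3) * (1 + 8 * (1 + Real.exp (kappa163 4 / 4))) * Real.exp (kappa163 4 / 4)))) * (2 * ((((3 : ℕ) : ℝ) + 1) * ((n : ℝ) * (((3 : ℕ) : ℝ) + 1)))) * Real.exp (2 * (kappa163 4 / 4)) :=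
        mul_le_mul_of_nonneg_left hE hpoly0
    _ ≤ 32 * ((MG163 4 * periodConst (kappa163 4) 3) * (1 + 8 * (1 + Real.exp (kappa163 4 / 4))) * Real.exp (kappa163 4 / 4)) * Real.exp (2 * (kappa163 4 / 4)) := mul_le_mul_of_nonneg_right hpoly (Real.exp_pos _).le

/-- [folklore] The majorant `GΘ*` is non-negative. -/
theorem faceGenStar_nonneg : 0 ≤ ((32 * ((MG163 4 * periodConst (kappa163 4) 3) * (1 + 8 * (1 + Real.exp (kappa163 4 / 4))) * Real.exp (kappa163 4 / 4))) * Real.exp (2 * (kappa163 4 / 4))) := by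
  have hC2 := cG_nonneg
  positivity

/-- [folklore] **THE H-TABLE VERTEX MASS TIMES THE DRESSING FACTOR, m-INDEPENDENT MAJORANT** at the rate `σ := κ₁∕(16n)`, `κ₁ := min κ′ κ₀` (`0 < κ₀`, `0 ≤ CΦ`):
`(1 + 4·(4·n))²·MV_H(n) ≤ 289·MV_H*`, `MV_H(n) = (n⁵)⁻¹(n³)⁻¹·K_Φ·(2·ell(4,n)²·e^{σ·16n})` (g63 PART B's constant), `MV_H* := K_Φ·(200·e^{κ₁})` — `ell 4 n = 10n`, `e^{σ·16n} = e^{κ₁}`,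
`(17n)²·n⁻⁸·n² ≤ 289`. -/
theorem vertexMassConst_dressed_le (hn : 1 ≤ n) {CΦ κ₀ : ℝ} (hCΦ : 0 ≤ CΦ) (hκ₀ : 0 < κ₀) :
    (1 + 4 * (((3 : ℝ) + 1) * n)) ^ 2 * ((((n : ℝ) ^ 5)⁻¹ * ((n : ℝ) ^ 3)⁻¹) * (4 * CΦ * Real.exp κ₀ * Real.exp (κ₀ / 2) * Zl 4 (κ₀ / 8))
            * (2 * (ell (3 + 1) n : ℝ) ^ 2 * Real.exp (((min (kappa163 4 / 4) κ₀) / (16 * ((n : ℕ) : ℝ))) * (4 * (((3 : ℝ) + 1) * (n : ℝ))))))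
      ≤ 289 * ((4 * CΦ * Real.exp κ₀ * Real.exp (κ₀ / 2) * Zl 4 (κ₀ / 8)) * (2 * 100 * Real.exp (min (kappa163 4 / 4) κ₀))) := by
  have hn0 : (n : ℝ) ≠ 0 := by exact_mod_cast (NeZero.ne n)
  have hnpos : (0 : ℝ) < n := by exact_mod_cast hn
  have hn1 : (1 : ℝ) ≤ n := by exact_mod_cast hn
  have hκ : 0 < kappa163 4 := kappa163_pos 4
  have hκ1 : 0 < (min (kappa163 4 / 4) κ₀) := lt_min (by positivity) hκ₀
  have hell : ((ell (3 + 1) n : ℕ) : ℝ) = 10 * (n : ℝ) := by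
    simp only [AveragingHessianKernels.ell]; push_cast; ring
  have hexp : Real.exp (((min (kappa163 4 / 4) κ₀) / (16 * ((n : ℕ) : ℝ))) * (4 * (((3 : ℝ) + 1) * (n : ℝ)))) = Real.exp (min (kappa163 4 / 4) κ₀) := by
    congr 1; field_simp; ring
  rw [hell, hexp]
  have hK : 0 ≤ (4 * CΦ * Real.exp κ₀ * Real.exp (κ₀ / 2) * Zl 4 (κ₀ / 8)) := by
    have hZ : 0 ≤ Zl 4 (κ₀ / 8) := Zl_nonneg (by positivity)
    positivity
  have h17 : 1 + 4 * (((3 : ℝ) + 1) * n) ≤ 17 * (n : ℝ) := by linarith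
  have h17' : (1 + 4 * (((3 : ℝ) + 1) * n)) ^ 2 ≤ (17 * (n : ℝ)) ^ 2 := pow_le_pow_left₀ (by positivity) h17 2
  have hpow : (1 + 4 * (((3 : ℝ) + 1) * n)) ^ 2 * ((((n : ℝ) ^ 5)⁻¹ * ((n : ℝ) ^ 3)⁻¹) * (10 * (n : ℝ)) ^ 2) ≤ 289 * 100 := by
    have e : (((n : ℝ) ^ 5)⁻¹ * ((n : ℝ) ^ 3)⁻¹) * (10 * (n : ℝ)) ^ 2 = 100 / (n : ℝ) ^ 6 := by field_simp; ring
    rw [e]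
    have h6 : (n : ℝ) ^ 2 ≤ (n : ℝ) ^ 6 := pow_le_pow_right₀ hn1 (by norm_num)
    calc (1 + 4 * (((3 : ℝ) + 1) * n)) ^ 2 * (100 / (n : ℝ) ^ 6)
        ≤ (17 * (n : ℝ)) ^ 2 * (100 / (n : ℝ) ^ 6) := mul_le_mul_of_nonneg_right h17' (by positivity)
      _ = 289 * 100 * ((n : ℝ) ^ 2 / (n : ℝ) ^ 6) := by ring
      _ ≤ 289 * 100 * 1 := by
          refine mul_le_mul_of_nonneg_left ((div_le_one (by positivity)).2 h6) (by norm_num)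
      _ = 289 * 100 := by ring
  have key : (1 + 4 * (((3 : ℝ) + 1) * n)) ^ 2 * ((((n : ℝ) ^ 5)⁻¹ * ((n : ℝ) ^ 3)⁻¹) * (4 * CΦ * Real.exp κ₀ * Real.exp (κ₀ / 2) * Zl 4 (κ₀ / 8)) * (2 * (10 * (n : ℝ)) ^ 2 * Real.exp (min (kappa163 4 / 4) κ₀)))
      ≤ 289 * ((4 * CΦ * Real.exp κ₀ * Real.exp (κ₀ / 2) * Zl 4 (κ₀ / 8)) * (2 * 100 * Real.exp (min (kappa163 4 / 4) κ₀))) := by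
    have e : (1 + 4 * (((3 : ℝ) + 1) * n)) ^ 2 * ((((n : ℝ) ^ 5)⁻¹ * ((n : ℝ) ^ 3)⁻¹) * (4 * CΦ * Real.exp κ₀ * Real.exp (κ₀ / 2) * Zl 4 (κ₀ / 8)) * (2 * (10 * (n : ℝ)) ^ 2 * Real.exp (min (kappa163 4 / 4) κ₀)))
        = (4 * CΦ * Real.exp κ₀ * Real.exp (κ₀ / 2) * Zl 4 (κ₀ / 8)) * (2 * ((1 + 4 * (((3 : ℝ) + 1) * n)) ^ 2 * ((((n : ℝ) ^ 5)⁻¹ * ((n : ℝ) ^ 3)⁻¹) * (10 * (n : ℝ)) ^ 2)) * Real.exp (min (kappa163 4 / 4) κ₀)) := by ring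
    have e' : 289 * ((4 * CΦ * Real.exp κ₀ * Real.exp (κ₀ / 2) * Zl 4 (κ₀ / 8)) * (2 * 100 * Real.exp (min (kappa163 4 / 4) κ₀))) = (4 * CΦ * Real.exp κ₀ * Real.exp (κ₀ / 2) * Zl 4 (κ₀ / 8)) * (2 * (289 * 100) * Real.exp (min (kappa163 4 / 4) κ₀)) := by ring
    rw [e, e']
    refine mul_le_mul_of_nonneg_left ?_ hK
    refine mul_le_mul_of_nonneg_right ?_ (Real.exp_pos _).le
    linarith
  refine le_trans (le_of_eq ?_) key
  ring

end Majorants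

/-! ## §2 Row (ms) on the scales: ONE constant for every `m` -/

section Scales

variable {Lc : ℕ} [NeZero Lc]

/-- **ROW (ms) ON THE SCALES WITH ONE m-INDEPENDENT CONSTANT** [our objects + folklore] — the `hAms ∕ hBms` binders of
`ChartDefectHeadScales.abs_secondMoment_chartDefect_scales_le_of_rows` (pin `hWms := fun _ _ _ _ ↦ rfl`): modulo the straight kernel's sup letter `hK₀ : ∀ m, Bdd (KInvStep 3 (Lc^m) 0) S₀`
(`0 ≤ S₀`) and the multiplier-column envelope `hΦ : ∀ m ρ ν w, |wΦ (N := Lc^m) ρ ν w| ≤ CΦ·((Lc^m)⁵)⁻¹·((Lc^m)³)⁻¹·e^{−κ₀‖w‖∞}` (`0 ≤ CΦ`, `0 < κ₀`), for every `m` the scale-`m` (ms) row kernel has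
absolutely summable (1.22) second moments and `|secondMoment (Wms m) μ ν| ≤ C_ms* := ((1∕4)·(S₀·(2·GΘ*·(289·MV_H*) + 2·GΘ*·(289·MV_H*))))·Σ'_x |x|₁²e^{−(κ₁∕16)|x|₁}` — per scale TT28
`decay510_row_ms_mass_of_wmass` at `σ_m := κ₁∕(16·Lc^m)` with `hV :=` g63 `wmass_vertexOfM_K₀_symHessFFAt_le_pairMass`, `hG :=` g63 `bdd_G₀_of_bdd`, the constant majorised by §1, then lit
`decay510_mono_const ∕ absMoment₂_of_decay510 ∕ secondMoment_abs_le_of_decay510`. -/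
theorem row_ms_scales {S₀ : ℝ} (hS₀ : 0 ≤ S₀) (hK₀ : ∀ m : ℕ, Bdd (KInvStep (d := 3) (Lc ^ m) 0) S₀)
    {CΦ κ₀ : ℝ} (hCΦ : 0 ≤ CΦ) (hκ₀ : 0 < κ₀)
    (hΦ : ∀ (m : ℕ) (ρ ν : Fin (3 + 1)) (w : Fin (3 + 1) → ℤ),
      |wΦ (N := Lc ^ m) ρ ν w| ≤ CΦ * (((Lc ^ m : ℕ) : ℝ) ^ 5)⁻¹ * (((Lc ^ m : ℕ) : ℝ) ^ 3)⁻¹ * Real.exp (-(κ₀ * supNorm w)))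
    (μ ν : Fin (3 + 1)) :
    (∀ (m : ℕ) (a e : Fin (3 + 1)), AbsMoment₂ (fun z : Site 4 => (1 / 2 : ℝ) * tadpole (coDressKBmAt (ctr 4 (Lc ^ m)) (Lc ^ m) (KInvStep (d := 3) (Lc ^ m) 0))
        (((mixOfK (coDressKBmAt (ctr 4 (Lc ^ m)) (Lc ^ m) (KInvStep (d := 3) (Lc ^ m) 0)) (Lc ^ m) (fun κ u ρ w => (if blk (Lc ^ m) (((Lc ^ m : ℕ) : ℤ) • w + (ctr 4 (Lc ^ m))) = blk (Lc ^ m) u then 2 * faceWt (ctrOff 4 (Lc ^ m)) (Lc ^ m) κ u else 0) • (symHessFFAt (ctr 4 (Lc ^ m)) (Lc ^ m)) ρ w) a 0 e z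
              + mixOfK (coDressKBmAt (ctr 4 (Lc ^ m)) (Lc ^ m) (KInvStep (d := 3) (Lc ^ m) 0)) (Lc ^ m) (fun κ u ρ w => (if blk (Lc ^ m) (((Lc ^ m : ℕ) : ℤ) • w + (ctr 4 (Lc ^ m))) = blk (Lc ^ m) u then 2 * faceWt (ctrOff 4 (Lc ^ m)) (Lc ^ m) κ u else 0) • (symHessFFAt (ctr 4 (Lc ^ m)) (Lc ^ m)) ρ w) e z a 0)
            - (comp (diagK fun x b => ∑ α : Fin (3 + 1), ∑ x' ∈ blockSitesF (Lc ^ m) (blk (Lc ^ m) (legSite (ctr 4 (Lc ^ m)) x b)), colH (coDressKBmAt (ctr 4 (Lc ^ m)) (Lc ^ m) (KInvStep (d := 3) (Lc ^ m) 0)) (Lc ^ m) a 0 α x' * (2 * faceWt (ctrOff 4 (Lc ^ m)) (Lc ^ m) α x')) (vertexOfM (coDressKBmAt (ctr 4 (Lc ^ m)) (Lc ^ m) (KInvStep (d := 3) (Lc ^ m) 0)) (Lc ^ m) (symHessFFAt (ctr 4 (Lc ^ m)) (Lc ^ m)) e z)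
              + comp (diagK fun x b => ∑ α : Fin (3 + 1), ∑ x' ∈ blockSitesF (Lc ^ m) (blk (Lc ^ m) (legSite (ctr 4 (Lc ^ m)) x b)), colH (coDressKBmAt (ctr 4 (Lc ^ m)) (Lc ^ m) (KInvStep (d := 3) (Lc ^ m) 0)) (Lc ^ m) e z α x' * (2 * faceWt (ctrOff 4 (Lc ^ m)) (Lc ^ m) α x')) (vertexOfM (coDressKBmAt (ctr 4 (Lc ^ m)) (Lc ^ m) (KInvStep (d := 3) (Lc ^ m) 0)) (Lc ^ m) (symHessFFAt (ctr 4 (Lc ^ m)) (Lc ^ m)) a 0)))))) ∧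
      ∀ m : ℕ, |B12Beta.secondMoment (fun (a e : Fin (3 + 1)) (z : Site 4) => (1 / 2 : ℝ) * tadpole (coDressKBmAt (ctr 4 (Lc ^ m)) (Lc ^ m) (KInvStep (d := 3) (Lc ^ m) 0))
        (((mixOfK (coDressKBmAt (ctr 4 (Lc ^ m)) (Lc ^ m) (KInvStep (d := 3) (Lc ^ m) 0)) (Lc ^ m) (fun κ u ρ w => (if blk (Lc ^ m) (((Lc ^ m : ℕ) : ℤ) • w + (ctr 4 (Lc ^ m))) = blk (Lc ^ m) u then 2 * faceWt (ctrOff 4 (Lc ^ m)) (Lc ^ m) κ u else 0) • (symHessFFAt (ctr 4 (Lc ^ m)) (Lc ^ m)) ρ w) a 0 e z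
              + mixOfK (coDressKBmAt (ctr 4 (Lc ^ m)) (Lc ^ m) (KInvStep (d := 3) (Lc ^ m) 0)) (Lc ^ m) (fun κ u ρ w => (if blk (Lc ^ m) (((Lc ^ m : ℕ) : ℤ) • w + (ctr 4 (Lc ^ m))) = blk (Lc ^ m) u then 2 * faceWt (ctrOff 4 (Lc ^ m)) (Lc ^ m) κ u else 0) • (symHessFFAt (ctr 4 (Lc ^ m)) (Lc ^ m)) ρ w) e z a 0)
            - (comp (diagK fun x b => ∑ α : Fin (3 + 1), ∑ x' ∈ blockSitesF (Lc ^ m) (blk (Lc ^ m) (legSite (ctr 4 (Lc ^ m)) x b)), colH (coDressKBmAt (ctr 4 (Lc ^ m)) (Lc ^ m) (KInvStep (d := 3) (Lc ^ m) 0)) (Lc ^ m) a 0 α x' * (2 * faceWt (ctrOff 4 (Lc ^ m)) (Lc ^ m) α x')) (vertexOfM (coDressKBmAt (ctr 4 (Lc ^ m)) (Lc ^ m) (KInvStep (d := 3) (Lc ^ m) 0)) (Lc ^ m) (symHessFFAt (ctr 4 (Lc ^ m)) (Lc ^ m)) e z)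
              + comp (diagK fun x b => ∑ α : Fin (3 + 1), ∑ x' ∈ blockSitesF (Lc ^ m) (blk (Lc ^ m) (legSite (ctr 4 (Lc ^ m)) x b)), colH (coDressKBmAt (ctr 4 (Lc ^ m)) (Lc ^ m) (KInvStep (d := 3) (Lc ^ m) 0)) (Lc ^ m) e z α x' * (2 * faceWt (ctrOff 4 (Lc ^ m)) (Lc ^ m) α x')) (vertexOfM (coDressKBmAt (ctr 4 (Lc ^ m)) (Lc ^ m) (KInvStep (d := 3) (Lc ^ m) 0)) (Lc ^ m) (symHessFFAt (ctr 4 (Lc ^ m)) (Lc ^ m)) a 0))))) μ ν|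
        ≤ ((1 / 4 : ℝ) * (S₀ * (2 * ((32 * ((MG163 4 * periodConst (kappa163 4) 3) * (1 + 8 * (1 + Real.exp (kappa163 4 / 4))) * Real.exp (kappa163 4 / 4))) * Real.exp (2 * (kappa163 4 / 4))) * (289 * ((4 * CΦ * Real.exp κ₀ * Real.exp (κ₀ / 2) * Zl 4 (κ₀ / 8)) * (2 * 100 * Real.exp (min (kappa163 4 / 4) κ₀))))
            + 2 * ((32 * ((MG163 4 * periodConst (kappa163 4) 3) * (1 + 8 * (1 + Real.exp (kappa163 4 / 4))) * Real.exp (kappa163 4 / 4))) * Real.exp (2 * (kappa163 4 / 4))) * (289 * ((4 * CΦ * Real.exp κ₀ * Real.exp (κ₀ / 2) * Zl 4 (κ₀ / 8)) * (2 * 100 * Real.exp (min (kappa163 4 / 4) κ₀)))))))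
          * ∑' x : Site 4, l1 x ^ 2 * Real.exp (-((min (kappa163 4 / 4) κ₀) / 16) * l1 x) := by
  have hκ : 0 < kappa163 4 := kappa163_pos 4
  have hκ1 : 0 < (min (kappa163 4 / 4) κ₀) := lt_min (by positivity) hκ₀
  have hrate : (0 : ℝ) < (min (kappa163 4 / 4) κ₀) / 16 := by positivity
  have hGs0 : 0 ≤ ((32 * ((MG163 4 * periodConst (kappa163 4) 3) * (1 + 8 * (1 + Real.exp (kappa163 4 / 4))) * Real.exp (kappa163 4 / 4))) * Real.exp (2 * (kappa163 4 / 4))) := faceGenStar_nonneg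
  have key : ∀ (m : ℕ) (a e : Fin (3 + 1)), Decay510 (fun z : Site 4 => (1 / 2 : ℝ) * tadpole (coDressKBmAt (ctr 4 (Lc ^ m)) (Lc ^ m) (KInvStep (d := 3) (Lc ^ m) 0))
        (((mixOfK (coDressKBmAt (ctr 4 (Lc ^ m)) (Lc ^ m) (KInvStep (d := 3) (Lc ^ m) 0)) (Lc ^ m) (fun κ u ρ w => (if blk (Lc ^ m) (((Lc ^ m : ℕ) : ℤ) • w + (ctr 4 (Lc ^ m))) = blk (Lc ^ m) u then 2 * faceWt (ctrOff 4 (Lc ^ m)) (Lc ^ m) κ u else 0) • (symHessFFAt (ctr 4 (Lc ^ m)) (Lc ^ m)) ρ w) a 0 e z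
              + mixOfK (coDressKBmAt (ctr 4 (Lc ^ m)) (Lc ^ m) (KInvStep (d := 3) (Lc ^ m) 0)) (Lc ^ m) (fun κ u ρ w => (if blk (Lc ^ m) (((Lc ^ m : ℕ) : ℤ) • w + (ctr 4 (Lc ^ m))) = blk (Lc ^ m) u then 2 * faceWt (ctrOff 4 (Lc ^ m)) (Lc ^ m) κ u else 0) • (symHessFFAt (ctr 4 (Lc ^ m)) (Lc ^ m)) ρ w) e z a 0)
            - (comp (diagK fun x b => ∑ α : Fin (3 + 1), ∑ x' ∈ blockSitesF (Lc ^ m) (blk (Lc ^ m) (legSite (ctr 4 (Lc ^ m)) x b)), colH (coDressKBmAt (ctr 4 (Lc ^ m)) (Lc ^ m) (KInvStep (d := 3) (Lc ^ m) 0)) (Lc ^ m) a 0 α x' * (2 * faceWt (ctrOff 4 (Lc ^ m)) (Lc ^ m) α x')) (vertexOfM (coDressKBmAt (ctr 4 (Lc ^ m)) (Lc ^ m) (KInvStep (d := 3) (Lc ^ m) 0)) (Lc ^ m) (symHessFFAt (ctr 4 (Lc ^ m)) (Lc ^ m)) e z)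
              + comp (diagK fun x b => ∑ α : Fin (3 + 1), ∑ x' ∈ blockSitesF (Lc ^ m) (blk (Lc ^ m) (legSite (ctr 4 (Lc ^ m)) x b)), colH (coDressKBmAt (ctr 4 (Lc ^ m)) (Lc ^ m) (KInvStep (d := 3) (Lc ^ m) 0)) (Lc ^ m) e z α x' * (2 * faceWt (ctrOff 4 (Lc ^ m)) (Lc ^ m) α x')) (vertexOfM (coDressKBmAt (ctr 4 (Lc ^ m)) (Lc ^ m) (KInvStep (d := 3) (Lc ^ m) 0)) (Lc ^ m) (symHessFFAt (ctr 4 (Lc ^ m)) (Lc ^ m)) a 0)))))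
      ((1 / 4 : ℝ) * (S₀ * (2 * ((32 * ((MG163 4 * periodConst (kappa163 4) 3) * (1 + 8 * (1 + Real.exp (kappa163 4 / 4))) * Real.exp (kappa163 4 / 4))) * Real.exp (2 * (kappa163 4 / 4))) * (289 * ((4 * CΦ * Real.exp κ₀ * Real.exp (κ₀ / 2) * Zl 4 (κ₀ / 8)) * (2 * 100 * Real.exp (min (kappa163 4 / 4) κ₀))))
            + 2 * ((32 * ((MG163 4 * periodConst (kappa163 4) 3) * (1 + 8 * (1 + Real.exp (kappa163 4 / 4))) * Real.exp (kappa163 4 / 4))) * Real.exp (2 * (kappa163 4 / 4))) * (289 * ((4 * CΦ * Real.exp κ₀ * Real.exp (κ₀ / 2) * Zl 4 (κ₀ / 8)) * (2 * 100 * Real.exp (min (kappa163 4 / 4) κ₀))))))) ((min (kappa163 4 / 4) κ₀) / 16) := by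
    intro m a e
    have hn1 : 1 ≤ Lc ^ m := Nat.one_le_iff_ne_zero.2 (pow_ne_zero _ (NeZero.ne Lc))
    have hnpos : (0 : ℝ) < ((Lc ^ m : ℕ) : ℝ) := by exact_mod_cast hn1
    -- the rate, admissible for both the generator and the multiplier column
    have hσpos : (0 : ℝ) < (min (kappa163 4 / 4) κ₀) / (16 * ((Lc ^ m : ℕ) : ℝ)) := by positivity
    have hσr : (min (kappa163 4 / 4) κ₀) / (16 * ((Lc ^ m : ℕ) : ℝ)) ≤ kappa163 4 / 4 / (4 * ((Lc ^ m : ℕ) : ℝ)) := by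
      rw [div_le_div_iff₀ (by positivity) (by positivity)]
      have hm : (min (kappa163 4 / 4) κ₀) ≤ kappa163 4 / 4 := min_le_left _ _
      nlinarith
    have hσΦ : (min (kappa163 4 / 4) κ₀) / (16 * ((Lc ^ m : ℕ) : ℝ)) ≤ κ₀ / (16 * ((Lc ^ m : ℕ) : ℝ)) :=
      div_le_div_of_nonneg_right (min_le_right _ _) (by positivity)
    -- the leg (g63 «G0-BDD») and the vertex letter (g63 «H-TABLE-MASS» PART B)
    have hG := bdd_G₀_of_bdd (Lc ^ m) (hK₀ m)
    have hS : (0 : ℝ) ≤ (1 + 4 * (((3 : ℝ) + 1) * ((Lc ^ m : ℕ) : ℝ))) ^ 2 * S₀ := by positivity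
    have hV := fun ν' y' => wmass_vertexOfM_K₀_symHessFFAt_le_pairMass (Lc ^ m) hκ₀ (hΦ m) hσpos.le hσΦ ν' y'
    have h := decay510_row_ms_mass_of_wmass (Lc ^ m) hn1 hG hS hσpos hσr hV a e
    have erate : ((Lc ^ m : ℕ) : ℝ) * ((min (kappa163 4 / 4) κ₀) / (16 * ((Lc ^ m : ℕ) : ℝ))) = (min (kappa163 4 / 4) κ₀) / 16 := by
      field_simp
    rw [erate] at h
    -- the constant is majorised uniformly in `m` (atoms abstracted before the algebra)
    have hGT := faceGenConst_le (Lc ^ m) hn1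
    have hMV := vertexMassConst_dressed_le (Lc ^ m) hn1 hCΦ hκ₀
    set G : ℝ := ((32 * ((MG163 4 * periodConst (kappa163 4) 3) * (1 + 8 * (1 + Real.exp (kappa163 4 / 4))) * Real.exp (kappa163 4 / 4))) * Real.exp (2 * (kappa163 4 / 4))) with hGdef
    set GT : ℝ := (((((Lc ^ m : ℕ) : ℝ) ^ 4)⁻¹ * ((MG163 4 * periodConst (kappa163 4) 3) * (1 + 8 * (1 + Real.exp (kappa163 4 / 4))) * Real.exp (kappa163 4 / 4)))
          * (2 * ((((3 : ℕ) : ℝ) + 1) * (((Lc ^ m : ℕ) : ℝ) * (((3 : ℕ) : ℝ) + 1))))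
          * Real.exp (kappa163 4 / 4 / (4 * ((Lc ^ m : ℕ) : ℝ)) * (l1 (ctr 4 (Lc ^ m)) + (((3 + 1 : ℕ) : ℝ) * ((Lc ^ m : ℕ) : ℝ))))) with hGTdef
    set MVs : ℝ := ((4 * CΦ * Real.exp κ₀ * Real.exp (κ₀ / 2) * Zl 4 (κ₀ / 8)) * (2 * 100 * Real.exp (min (kappa163 4 / 4) κ₀))) with hMVsdef
    set MV : ℝ := (((((Lc ^ m : ℕ) : ℝ) ^ 5)⁻¹ * (((Lc ^ m : ℕ) : ℝ) ^ 3)⁻¹) * (4 * CΦ * Real.exp κ₀ * Real.exp (κ₀ / 2) * Zl 4 (κ₀ / 8))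
            * (2 * (ell (3 + 1) (Lc ^ m) : ℝ) ^ 2 * Real.exp (((min (kappa163 4 / 4) κ₀) / (16 * ((Lc ^ m : ℕ) : ℝ))) * (4 * (((3 : ℝ) + 1) * ((Lc ^ m : ℕ) : ℝ)))))) with hMVdef
    set A : ℝ := (1 + 4 * (((3 : ℝ) + 1) * ((Lc ^ m : ℕ) : ℝ))) ^ 2 with hAdef
    refine decay510_mono_const h ?_
    have hGT0 : 0 ≤ GT := by
      have h0 := (abs_nonneg _).trans ((ChartDefectRowMsMass.abs_faceGen_G₀_legSite_le (Lc ^ m) hn1 0 0 0 (Sum.inl 0)))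
      exact (mul_nonneg_iff_of_pos_right (Real.exp_pos _)).1 h0
    have hMV0 : 0 ≤ MV := le_trans (tsum_nonneg fun p => mul_nonneg (Finset.sum_nonneg fun a _ => Finset.sum_nonneg fun b _ => abs_nonneg _) (Real.exp_pos _).le) (hV 0 0).2
    have hMVs0 : 0 ≤ 289 * MVs := le_trans (mul_nonneg (sq_nonneg _) hMV0) hMV
    have h1 : GT * (A * MV) ≤ G * (289 * MVs) := mul_le_mul hGT hMV (mul_nonneg (sq_nonneg _) hMV0) hGs0
    have h2 : 2 * (GT * (A * MV)) ≤ 2 * (G * (289 * MVs)) := by linarith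
    have hb : 0 ≤ 2 * G * (289 * MVs) := mul_nonneg (mul_nonneg (by norm_num) hGs0) hMVs0
    calc (1 / 4 : ℝ) * (A * S₀ * (2 * GT * MV + 2 * GT * MV))
        = (1 / 4 : ℝ) * (S₀ * (2 * (GT * (A * MV)) + 2 * (GT * (A * MV)))) := by ring
      _ ≤ (1 / 4 : ℝ) * (S₀ * (2 * G * (289 * MVs) + 2 * G * (289 * MVs))) := by
          have h3 : S₀ * (2 * (GT * (A * MV)) + 2 * (GT * (A * MV))) ≤ S₀ * (2 * G * (289 * MVs) + 2 * G * (289 * MVs)) :=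
            mul_le_mul_of_nonneg_left (by linarith) hS₀
          linarith
  refine ⟨fun m a e => absMoment₂_of_decay510 hrate (key m a e), fun m => ?_⟩
  exact (secondMoment_abs_le_of_decay510 (P := fun (a e : Fin (3 + 1)) (z : Site 4) => (1 / 2 : ℝ) * tadpole (coDressKBmAt (ctr 4 (Lc ^ m)) (Lc ^ m) (KInvStep (d := 3) (Lc ^ m) 0))
        (((mixOfK (coDressKBmAt (ctr 4 (Lc ^ m)) (Lc ^ m) (KInvStep (d := 3) (Lc ^ m) 0)) (Lc ^ m) (fun κ u ρ w => (if blk (Lc ^ m) (((Lc ^ m : ℕ) : ℤ) • w + (ctr 4 (Lc ^ m))) = blk (Lc ^ m) u then 2 * faceWt (ctrOff 4 (Lc ^ m)) (Lc ^ m) κ u else 0) • (symHessFFAt (ctr 4 (Lc ^ m)) (Lc ^ m)) ρ w) a 0 e z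
              + mixOfK (coDressKBmAt (ctr 4 (Lc ^ m)) (Lc ^ m) (KInvStep (d := 3) (Lc ^ m) 0)) (Lc ^ m) (fun κ u ρ w => (if blk (Lc ^ m) (((Lc ^ m : ℕ) : ℤ) • w + (ctr 4 (Lc ^ m))) = blk (Lc ^ m) u then 2 * faceWt (ctrOff 4 (Lc ^ m)) (Lc ^ m) κ u else 0) • (symHessFFAt (ctr 4 (Lc ^ m)) (Lc ^ m)) ρ w) e z a 0)
            - (comp (diagK fun x b => ∑ α : Fin (3 + 1), ∑ x' ∈ blockSitesF (Lc ^ m) (blk (Lc ^ m) (legSite (ctr 4 (Lc ^ m)) x b)), colH (coDressKBmAt (ctr 4 (Lc ^ m)) (Lc ^ m) (KInvStep (d := 3) (Lc ^ m) 0)) (Lc ^ m) a 0 α x' * (2 * faceWt (ctrOff 4 (Lc ^ m)) (Lc ^ m) α x')) (vertexOfM (coDressKBmAt (ctr 4 (Lc ^ m)) (Lc ^ m) (KInvStep (d := 3) (Lc ^ m) 0)) (Lc ^ m) (symHessFFAt (ctr 4 (Lc ^ m)) (Lc ^ m)) e z)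
              + comp (diagK fun x b => ∑ α : Fin (3 + 1), ∑ x' ∈ blockSitesF (Lc ^ m) (blk (Lc ^ m) (legSite (ctr 4 (Lc ^ m)) x b)), colH (coDressKBmAt (ctr 4 (Lc ^ m)) (Lc ^ m) (KInvStep (d := 3) (Lc ^ m) 0)) (Lc ^ m) e z α x' * (2 * faceWt (ctrOff 4 (Lc ^ m)) (Lc ^ m) α x')) (vertexOfM (coDressKBmAt (ctr 4 (Lc ^ m)) (Lc ^ m) (KInvStep (d := 3) (Lc ^ m) 0)) (Lc ^ m) (symHessFFAt (ctr 4 (Lc ^ m)) (Lc ^ m)) a 0))))) hrate (key m μ ν)).2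

end Scales

end Summit.QuantumFields.BalabanUV.Beta.D1BFx.ChartDefectRowMsScales

end
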